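import Summits.HodgeConjecture.HodgeConjecture.Theorems.Ring2WeilCoverageCMTypeSetPairCount
import Mathlib.Data.ZMod.Units
import HarnessLib

/-!
# Weil-type family coverage — CM TYPE SETS UNDER THE CHINESE REMAINDER THEOREM: even products do not depend on
# the CM type set, unit multiples of CM type sets, and the product set `T₀ × (ℤ/m′)ˣ ⊂ (ℤ/n₀m′)ˣ`

research route conditional on HC_CM; not a corollary; Q11.4-sentence-2 already refuted in dim ≥ 3.

Ring 2, WEIL-TYPE FAMILY-COVERAGE CENSUS (`HOME/WEIL-FAMILY-COVERAGE.md` `## b01`, block b01.44: THEOREM L (i) at every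
level; owner ring2-b01), part 65 of the `Ring2WeilCoverage*` series — the combinatorial input of part 66's
reduction argument.  A CM type set mod `m` (`IsCMTypeSet m S`, Literature `FermatCMTypesFortyTwo`) is a set of unit
residues containing exactly one of `t, −t` for every unit `t` — the residue picture of a CM type of `ℚ(ζₘ)`.

* §1 `prod_eq_prod_of_isCMTypeSet` — **the product of an EVEN function of unit residues over a CM type set is the same
  for all CM type sets** (bijection `t ↦ ±t`); `isCMTypeSet_image_mul` — `a·S` is a CM type set for a unit `a`.
* §2 the Chinese remainder isomorphism `e : ℤ/(n₀m′) ≅ ℤ/n₀ × ℤ/m′` (Mathlib `ZMod.chineseRemainder`): its components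
  are the reductions (`chineseRemainder_fst/snd`), units correspond to pairs of units (`isUnit_iff_chineseRemainder`),
  and **`isCMTypeSet_chineseRemainder`: for a CM type set `T₀` mod `n₀`, `e⁻¹(T₀ × (ℤ/m′)ˣ)` is a CM type set mod
  `n₀m′`** — the half-system of `(ℤ/n₀m′)ˣ` lying over a half-system of `(ℤ/n₀)ˣ` (this needs `−1 ≢ 1 (mod n₀)`, which
  is built into the existence of `T₀`); `card_image_units` — the fibres have `φ(m′)` elements.

HONEST FRAMING: finite combinatorics of residues; nothing here mentions Hodge classes, polarisations, `W_K` or HC;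
`HC_CM` is used nowhere.  No `def`, no named fact, no `sorry`.

References: [cite: Aoki2002CMFermatType, §1 (p. 102) and §2 eq. (5) (p. 103)] (CM types of `ℚ(ζₘ)` as half-systems);
census b01.44 (seat-derived).
-/

noncomputable section

open scoped Classical
open Finset

namespace Summit.HodgeConjecture.Ring2WeilCoverage.CMTypeSetChineseRemainder

open Literature.AlgebraicGeometry.HodgeTheory (IsCMTypeSet)
open Summit.HodgeConjecture.Ring2WeilCoverage.CMTypeSetPairCount (coprime_val_neg neg_mem_iff_not_mem)

/-! ### §1 Even products and unit multiples -/

section CMTypeSets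

variable {m : ℕ} [NeZero m]

/-- A residue mod `m` has value coprime to `m` iff it is a unit of `ℤ/m`.
research route conditional on HC_CM; not a corollary; Q11.4-sentence-2 already refuted in dim ≥ 3. [folklore] -/
theorem coprime_iff_isUnit (t : ZMod m) : t.val.Coprime m ↔ IsUnit t := by
  rw [← ZMod.isUnit_iff_coprime, ZMod.natCast_zmod_val]

/-- **The product of an EVEN function over a CM type set does not depend on the CM type set**: if
`F (−t) = F t` for every unit residue `t`, then `∏_{t ∈ S} F t = ∏_{t ∈ S'} F t` for any two CM type sets
`S, S'` mod `m` (the bijection `S → S'`, `t ↦ ±t`).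
research route conditional on HC_CM; not a corollary; Q11.4-sentence-2 already refuted in dim ≥ 3. [folklore] -/
theorem prod_eq_prod_of_isCMTypeSet {M : Type*} [CommMonoid M] {S S' : Finset (ZMod m)}
    (hS : IsCMTypeSet m S) (hS' : IsCMTypeSet m S') (F : ZMod m → M)
    (hF : ∀ t : ZMod m, t.val.Coprime m → F (-t) = F t) : ∏ t ∈ S, F t = ∏ t ∈ S', F t := by
  refine Finset.prod_nbij' (fun t => if t ∈ S' then t else -t) (fun t => if t ∈ S then t else -t)
    ?_ ?_ ?_ ?_ ?_
  · intro t ht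
    by_cases h : t ∈ S'
    · rw [if_pos h]; exact h
    · rw [if_neg h]; exact (neg_mem_iff_not_mem hS' (hS.1 t ht)).mpr h
  · intro t ht
    by_cases h : t ∈ S
    · rw [if_pos h]; exact h
    · rw [if_neg h]; exact (neg_mem_iff_not_mem hS (hS'.1 t ht)).mpr h
  · intro t ht
    by_cases h : t ∈ S'
    · rw [if_pos h, if_pos ht]
    · rw [if_neg h, if_neg ((hS.2 t (hS.1 t ht)).mp ht), neg_neg]
  · intro t ht
    by_cases h : t ∈ S
    · rw [if_pos h, if_pos ht]
    · rw [if_neg h, if_neg ((hS'.2 t (hS'.1 t ht)).mp ht), neg_neg]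
  · intro t ht
    by_cases h : t ∈ S'
    · rw [if_pos h]
    · rw [if_neg h, hF t (hS.1 t ht)]

/-- **A unit multiple of a CM type set is a CM type set**: `a·S` for `a ∈ (ℤ/m)ˣ`.
research route conditional on HC_CM; not a corollary; Q11.4-sentence-2 already refuted in dim ≥ 3. [folklore] -/
theorem isCMTypeSet_image_mul {S : Finset (ZMod m)} (hS : IsCMTypeSet m S) {a : ZMod m} (ha : IsUnit a) :
    IsCMTypeSet m (S.image (a * ·)) := by
  obtain ⟨a, rfl⟩ := ha
  have hmem : ∀ t : ZMod m, t ∈ S.image ((a : ZMod m) * ·) ↔ (↑a⁻¹ : ZMod m) * t ∈ S := by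
    intro t
    rw [Finset.mem_image]
    constructor
    · rintro ⟨s, hs, rfl⟩
      rwa [Units.inv_mul_cancel_left]
    · intro h
      exact ⟨_, h, by rw [Units.mul_inv_cancel_left]⟩
  refine ⟨fun t ht => ?_, fun t ht => ?_⟩
  · obtain ⟨s, hs, rfl⟩ := Finset.mem_image.mp ht
    exact (coprime_iff_isUnit _).mpr (a.isUnit.mul ((coprime_iff_isUnit s).mp (hS.1 s hs)))
  · rw [hmem t, hmem (-t), mul_neg]
    exact hS.2 _ ((coprime_iff_isUnit _).mpr (a⁻¹.isUnit.mul ((coprime_iff_isUnit t).mp ht)))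

/-! ### §2 The Chinese-remainder product set -/

variable {n₀ m' : ℕ} [NeZero n₀] [NeZero m']

/-- The first component of the Chinese-remainder isomorphism `ℤ/(n₀m') ≅ ℤ/n₀ × ℤ/m'` is reduction mod `n₀`.
research route conditional on HC_CM; not a corollary; Q11.4-sentence-2 already refuted in dim ≥ 3. [folklore] -/
theorem chineseRemainder_fst (h : n₀.Coprime m') (t : ZMod (n₀ * m')) :
    (ZMod.chineseRemainder h t).1 = (t.val : ZMod n₀) := by
  rw [show ZMod.chineseRemainder h t = (ZMod.cast t : ZMod n₀ × ZMod m') from rfl, ZMod.cast_eq_val,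
    Prod.fst_natCast]

/-- The second component of the Chinese-remainder isomorphism is reduction mod `m'`.
research route conditional on HC_CM; not a corollary; Q11.4-sentence-2 already refuted in dim ≥ 3. [folklore] -/
theorem chineseRemainder_snd (h : n₀.Coprime m') (t : ZMod (n₀ * m')) :
    (ZMod.chineseRemainder h t).2 = (t.val : ZMod m') := by
  rw [show ZMod.chineseRemainder h t = (ZMod.cast t : ZMod n₀ × ZMod m') from rfl, ZMod.cast_eq_val,
    Prod.snd_natCast]

omit [NeZero n₀] [NeZero m'] in
/-- A residue mod `n₀m'` is a unit iff both of its Chinese-remainder components are units.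
research route conditional on HC_CM; not a corollary; Q11.4-sentence-2 already refuted in dim ≥ 3. [folklore] -/
theorem isUnit_iff_chineseRemainder (h : n₀.Coprime m') (t : ZMod (n₀ * m')) :
    IsUnit t ↔ IsUnit (ZMod.chineseRemainder h t).1 ∧ IsUnit (ZMod.chineseRemainder h t).2 := by
  rw [← Prod.isUnit_iff]
  constructor
  · exact fun ht => ht.map _
  · intro ht
    have := ht.map (ZMod.chineseRemainder h).symm
    rwa [RingEquiv.symm_apply_apply] at this

/-- Reduction mod `n₀` of the Chinese-remainder lift of `(s, a)` is `s`.
research route conditional on HC_CM; not a corollary; Q11.4-sentence-2 already refuted in dim ≥ 3. [folklore] -/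
theorem val_chineseRemainder_symm_cast (h : n₀.Coprime m') (x : ZMod n₀ × ZMod m') :
    (((ZMod.chineseRemainder h).symm x).val : ZMod n₀) = x.1 := by
  rw [← chineseRemainder_fst h, RingEquiv.apply_symm_apply]

omit [NeZero n₀] [NeZero m'] in
/-- The Chinese-remainder lift of a pair of units is a unit.
research route conditional on HC_CM; not a corollary; Q11.4-sentence-2 already refuted in dim ≥ 3. [folklore] -/
theorem isUnit_chineseRemainder_symm (h : n₀.Coprime m') {x : ZMod n₀ × ZMod m'} (h1 : IsUnit x.1)
    (h2 : IsUnit x.2) : IsUnit ((ZMod.chineseRemainder h).symm x) := by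
  rw [isUnit_iff_chineseRemainder h, RingEquiv.apply_symm_apply]
  exact ⟨h1, h2⟩

/-- **The Chinese-remainder product set**: for a CM type set `T₀` mod `n₀` and `(n₀, m') = 1`, the set of residues
mod `n₀m'` whose reduction mod `n₀` lies in `T₀` and whose reduction mod `m'` is a unit — the image of
`T₀ × (ℤ/m')ˣ` under the Chinese-remainder isomorphism — is a CM type set mod `n₀m'` (`−1 ≢ 1 (mod n₀)` is built
into the existence of `T₀`).
research route conditional on HC_CM; not a corollary; Q11.4-sentence-2 already refuted in dim ≥ 3. [folklore] -/
theorem isCMTypeSet_chineseRemainder (h : n₀.Coprime m') {T₀ : Finset (ZMod n₀)} (hT₀ : IsCMTypeSet n₀ T₀) :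
    IsCMTypeSet (n₀ * m') ((T₀ ×ˢ (Finset.univ.image fun a : (ZMod m')ˣ => (a : ZMod m'))).image
      (ZMod.chineseRemainder h).symm) := by
  set e := ZMod.chineseRemainder h with he
  have hmem : ∀ t : ZMod (n₀ * m'),
      t ∈ (T₀ ×ˢ (Finset.univ.image fun a : (ZMod m')ˣ => (a : ZMod m'))).image e.symm ↔
        (e t).1 ∈ T₀ ∧ IsUnit (e t).2 := by
    intro t
    rw [Finset.mem_image]
    constructor
    · rintro ⟨x, hx, rfl⟩
      rw [RingEquiv.apply_symm_apply]
      obtain ⟨hx1, hx2⟩ := Finset.mem_product.mp hx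
      obtain ⟨a, -, ha⟩ := Finset.mem_image.mp hx2
      exact ⟨hx1, ha ▸ a.isUnit⟩
    · rintro ⟨h1, h2⟩
      refine ⟨e t, Finset.mem_product.mpr ⟨h1, ?_⟩, RingEquiv.symm_apply_apply e t⟩
      exact Finset.mem_image.mpr ⟨h2.unit, Finset.mem_univ _, rfl⟩
  refine ⟨fun t ht => ?_, fun t ht => ?_⟩
  · obtain ⟨h1, h2⟩ := (hmem t).mp ht
    exact (coprime_iff_isUnit t).mpr ((isUnit_iff_chineseRemainder h t).mpr
      ⟨(coprime_iff_isUnit _).mp (hT₀.1 _ h1), h2⟩)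
  · obtain ⟨hu1, hu2⟩ := (isUnit_iff_chineseRemainder h t).mp ((coprime_iff_isUnit t).mp ht)
    rw [hmem t, hmem (-t), map_neg, Prod.fst_neg, Prod.snd_neg]
    have key := hT₀.2 _ ((coprime_iff_isUnit _).mpr hu1)
    constructor
    · rintro ⟨h1, -⟩ ⟨h1', -⟩
      exact (key.mp h1) h1'
    · intro hnot
      refine ⟨?_, hu2⟩
      by_contra h1
      exact hnot ⟨(neg_mem_iff_not_mem hT₀ ((coprime_iff_isUnit _).mpr hu1)).mpr h1, hu2.neg⟩

/-- The unit set of `ℤ/m'` as a finset of residues has `φ(m')` elements.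
research route conditional on HC_CM; not a corollary; Q11.4-sentence-2 already refuted in dim ≥ 3. [folklore] -/
theorem card_image_units : (Finset.univ.image fun a : (ZMod m')ˣ => (a : ZMod m')).card = Nat.totient m' := by
  rw [Finset.card_image_of_injective _ Units.val_injective, Finset.card_univ, ZMod.card_units_eq_totient]

end CMTypeSets

end Summit.HodgeConjecture.Ring2WeilCoverage.CMTypeSetChineseRemainder

end
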